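import Literature.Analysis.FunctionSpaces.PV1WitnessForms
import Literature.Computability.Complexity.BoundedArithmeticHerbrand
import HarnessLib

/-!
# `S₂¹(PV)` is `∀Σᵇ₁(PV)`-conservative over `PV₁` — Herbrand-saturated models of `PV₁` are
models of `S₂¹(PV)`, and the discharge of the named fact

Sibling proof file of `PVTheory.lean` (D-0014), top of the toolkit `PV1Model`, `PV1Symbols`,
`PV1Skolem`, `PV1Saturation`, `PV1Coding`, `PV1WitnessForms`.  We prove

* `model_S2PV_one_of_isHerbrandSaturated` — **Krajíček 1995, Thm. 7.6.3 (1) for the axiomatised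
  theory `PV₁`**, in Avigad's formulation (Avigad 2002, §4): every Herbrand-saturated model of
  `PV₁` satisfies `Σᵇ₁(PV)-PIND`, hence is a model of `S₂¹(PV)`;
* `Literature.Analysis.FunctionSpaces.S2PV_one_isConservativeOver_PV1_holds :
  S2PV_one_isConservativeOver_PV1` — every `∀Σᵇ₁(PV)` sentence which is a (semantic) consequence
  of `S₂¹(PV)` is a consequence of `PV₁`: Buss's main theorem on `S₂¹(PV)` and `PV₁` (Buss 1986,
  Ch. 6: Thm. 6.4 and Cor. 6.8 via the witnessing Thm. 6.7), in the form printed as Krajíček 1995,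
  Cor. 7.2.4 ("`S₂¹` is `Σᵇ₁`-conservative over `PV₁`"), by the model-theoretic route
  (Krajíček 1995, Thm. 7.6.3 after Zambella 1996; Avigad 2002, Thm. 3.2 and §4).

## The `PIND` argument (`PV1.pind_of_isSigmabPV_one`)

For a `Σᵇ₁(PV)` formula `φ(p̄, x)` with `φ(p̄, 0)` and `∀ x (φ(p̄, ⌊x/2⌋) → φ(p̄, x))` in an
Herbrand-saturated `K ⊨ PV₁`, and a target `a`:
1. take the witness form `φ(p̄, x) ↔ ∃ w ≤ T(p̄, x) E(p̄, x, w)` (`hasSigmaFormPV_of_isSigmabPV_one`,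
   complete in `K` because `K` is Herbrand saturated, sound because `K ⊨ PV₁`);
2. the step `∀ x w ∃ w' (w ≤ T(p̄,⌊x/2⌋) ∧ E(p̄,⌊x/2⌋,w) → w' ≤ T(p̄,x) ∧ E(p̄,x,w'))` holds in
   `K`, so Herbrand saturation gives a Skolem *symbol* `G(c̄, x, w)` (`PV1.exists_skolem_sym_ctx₂`);
3. iterate `G` along the notation of `x` by limited recursion (`PVFun.iterSym`, bound the
   constant `T(p̄, a)`, which dominates `T(p̄, x)` for `x ≤ a` as `T` is monotone);
4. the invariant "`x ≤ a → H(x) ≤ T(p̄, x) ∧ E(p̄, x, H(x))`" is *open*, so **open `PIND`, which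
   holds in `K ⊨ PV₁`**, proves it for all `x`; at `x = a` soundness gives `φ(p̄, a)`
   (Krajíček 1995, p. 116: "by induction for the formula `ψ(x, u_x)` available in `PV₁`").

## The conservation argument (`S2PV_one_isConservativeOver_PV1_holds`)

1. Let `M ⊨ PV₁` and let `∀x̄ ψ(x̄)` be a `∀Σᵇ₁(PV)` consequence of `S₂¹(PV)`.  Map `M` into an
   Herbrand-saturated `K ⊨ PV₁` by `f` preserving universal formulas with parameters
   (`exists_herbrandSaturated_model_PV1`: Avigad's Thm. 3.2 for the universal theory `univPV1`,
   whose models are models of `PV₁`).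
2. `K ⊨ S₂¹(PV)`, so `K ⊨ ψ(f x̄)`.
3. The witness form of `ψ` is complete in `K`: `K ⊨ ∃ w (w ≤ T(f x̄) ∧ E(f x̄, w))`; this
   existential statement is reflected by `f`, so `M ⊨ ∃ w ≤ T(x̄) E(x̄, w)`, and the form is sound
   in `M ⊨ PV₁`, whence `M ⊨ ψ(x̄)` (`realize_of_realize_comp_of_isSigmabPV_one`).

## References

* S. R. Buss, *Bounded Arithmetic*, Bibliopolis 1986, Ch. 6 (Thm. 6.4, Thm. 6.7, Cor. 6.8).
* J. Krajíček, *Bounded Arithmetic, Propositional Logic and Complexity Theory*, CUP 1995,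
  Cor. 7.2.4 (p. 100), Thm. 7.6.3 (p. 116).
* J. Avigad, *Saturated models of universal theories*, APAL 118 (2002), Thm. 3.2, §4.
* D. Zambella, *Notes on polynomially bounded arithmetic*, JSL 61 (1996).
-/

namespace Literature.Analysis.FunctionSpaces

open FirstOrder FirstOrder.Language FirstOrder.Language.BoundedFormula
open Literature.Computability.MetaComplexity Literature.Computability.MetaComplexity.BASICModel
open Literature.ModelTheory.UniversalTheories

attribute [local instance] pvReduct isExpansionOn_pvReduct

/-! ## Iteration of a step symbol along a notation -/

namespace PVFun

variable {q : ℕ}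

/-- **Iteration along a notation**: `iterSym G (c̄, w₀, K₀, 0) = min (w₀, K₀)`,
`iterSym G (c̄, w₀, K₀, s_b y) = min (G(c̄, s_b y, iterSym G (c̄, w₀, K₀, y)), K₀)` — limited
recursion on notation with the constant bound `K₀` (Krajíček 1995, p. 116: the sequence
`u₀ := u`, `u_{j+1} := f(j, u_j)`; Cook 1975, §2). [cite: Krajicek1995, Thm. 7.6.3] -/
def iterSym (G : PVFun (q + 2)) : PVFun (q + 3) :=
  limRec (proj (Fin.castSucc (Fin.last q)))
    (fun b => comp G (Fin.snoc (Fin.snoc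
      (fun i => proj (Fin.castSucc (Fin.castSucc (Fin.castSucc (Fin.castSucc i)))))
      (ap₁ (bit b) yv)) rv))
    (proj (Fin.castSucc (Fin.last (q + 1))))

end PVFun

namespace PV1

variable {K : Type} [Language.pv.Structure K]

section Iter

variable [hKB : K ⊨ BASIC] {q : ℕ}

/-- The base of the iteration: `iterSym G (c̄, w₀, K₀, 0) = min (w₀, K₀)`. [folklore] -/
theorem iterSym_zero (hD : K ⊨ PVdef) (G : PVFun (q + 2)) (c : Fin q → K) (w₀ K₀ : K) :
    papp (PVFun.iterSym G) (Fin.snoc (Fin.snoc (Fin.snoc c w₀) K₀) 0) = min w₀ K₀ := by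
  rw [PVFun.iterSym, papp_limRec_zero hD, papp_proj hD, papp_proj hD]
  simp

/-- The step of the iteration: for `s_b y ≠ 0`,
`iterSym G (c̄, w₀, K₀, s_b y) = min (G(c̄, s_b y, iterSym G (c̄, w₀, K₀, y)), K₀)`. [folklore] -/
theorem iterSym_pbit (hD : K ⊨ PVdef) (G : PVFun (q + 2)) (c : Fin q → K) (w₀ K₀ : K)
    {b : Bool} {y : K} (hy : pbit b y ≠ 0) :
    papp (PVFun.iterSym G) (Fin.snoc (Fin.snoc (Fin.snoc c w₀) K₀) (pbit b y)) =
      min (papp G (Fin.snoc (Fin.snoc c (pbit b y))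
        (papp (PVFun.iterSym G) (Fin.snoc (Fin.snoc (Fin.snoc c w₀) K₀) y)))) K₀ := by
  rw [PVFun.iterSym, papp_limRec_bit hD b _ _ _ _ _ hy, ← PVFun.iterSym, papp_proj hD,
    papp_comp hD]
  congr 1
  · congr 1; funext i
    cases i using Fin.lastCases with
    | last => simp [papp_rv hD]
    | cast i =>
      cases i using Fin.lastCases with
      | last =>
        simp only [Fin.snoc_castSucc, Fin.snoc_last, papp_ap₁ hD, papp_yv hD]
      | cast i => simp [papp_proj hD]
  · simp

end Iter

/-! ## Definability of instances of open formulas -/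

section Def

variable {m k : ℕ}

/-- **An open formula in context variables, instantiated at term functions, is an open-definable
predicate** (with parameters). [folklore] -/
theorem isQFPVDef_realize_of_isQF {E : Language.pv.BoundedFormula Empty k} (hE : E.IsQF)
    {F : Fin k → (Fin m → K) → K} (hF : ∀ i, IsPVTermFn (F i)) :
    IsQFPVDef fun v : Fin m → K => E.Realize (default : Empty → K) fun i => F i v := by
  choose t ht using hF
  refine ⟨(E.toFormula).subst (Sum.elim Empty.elim t), isQF_subst hE.toFormula _, fun v => ?_⟩
  rw [Formula.Realize, realize_subst, ← Formula.Realize, realize_toFormula]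
  have e1 : (fun a => Term.realize (pvEnv v) (Sum.elim Empty.elim t a)) ∘ Sum.inl =
      (default : Empty → K) := Subsingleton.elim _ _
  have e2 : (fun a => Term.realize (pvEnv v) (Sum.elim Empty.elim t a)) ∘ Sum.inr =
      fun i => F i v := by
    funext i; simp [ht]
  rw [e1, e2]

end Def

/-! ## `Σᵇ₁(PV)-PIND` in an Herbrand-saturated model of `PV₁` -/

section PIND

variable [hKB : K ⊨ BASIC] {k : ℕ}

/-- The Skolemization matrix of the induction step:
`(w ≤ T(p̄,⌊x/2⌋) ∧ E(p̄,⌊x/2⌋,w)) → (w' ≤ T(p̄,x) ∧ E(p̄,x,w'))` in the context `(p̄, x, w, w')`.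
[folklore] -/
def stepTheta (E : Language.pv.BoundedFormula Empty (k + 2)) (T : PVFun (k + 1)) :
    Language.pv.BoundedFormula Empty (k + 3) :=
  let pv : Fin k → Language.pv.Term (Empty ⊕ Fin (k + 3)) :=
    fun i => cv (Fin.castSucc (Fin.castSucc (Fin.castSucc i)))
  let x : Language.pv.Term (Empty ⊕ Fin (k + 3)) := cv (Fin.castSucc (Fin.castSucc (Fin.last k)))
  let w : Language.pv.Term (Empty ⊕ Fin (k + 3)) := cv (Fin.castSucc (Fin.last (k + 1)))
  let w' : Language.pv.Term (Empty ⊕ Fin (k + 3)) := cv (Fin.last (k + 2))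
  (Term.le w (Term.func T (Fin.snoc pv (pvHalf x))) ⊓
      substCtx E (Fin.snoc (Fin.snoc pv (pvHalf x)) w)) ⟹
    (Term.le w' (Term.func T (Fin.snoc pv x)) ⊓ substCtx E (Fin.snoc (Fin.snoc pv x) w'))

/-- `stepTheta` is open. [folklore] -/
theorem isQF_stepTheta {E : Language.pv.BoundedFormula Empty (k + 2)} (hE : E.IsQF)
    (T : PVFun (k + 1)) : (stepTheta E T).IsQF :=
  ((IsAtomic.rel _ _).isQF.inf (isQF_substCtx hE _)).imp
    ((IsAtomic.rel _ _).isQF.inf (isQF_substCtx hE _))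

/-- Semantics of `stepTheta`. [folklore] -/
theorem realize_stepTheta (E : Language.pv.BoundedFormula Empty (k + 2)) (T : PVFun (k + 1))
    (p : Fin k → K) (x w w' : K) :
    (stepTheta E T).Realize default (Fin.snoc (Fin.snoc (Fin.snoc p x) w) w') ↔
      ((w ≤ papp T (Fin.snoc p (mHalf x)) ∧ E.Realize default (Fin.snoc (Fin.snoc p (mHalf x)) w)) →
        (w' ≤ papp T (Fin.snoc p x) ∧ E.Realize default (Fin.snoc (Fin.snoc p x) w'))) := by
  have ev : ∀ (t s : Language.pv.Term (Empty ⊕ Fin (k + 3))),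
      (fun i => Term.realize (Sum.elim (default : Empty → K) (Fin.snoc (Fin.snoc (Fin.snoc p x) w) w'))
        ((Fin.snoc (Fin.snoc (fun i : Fin k => (cv (Fin.castSucc (Fin.castSucc (Fin.castSucc i))) :
          Language.pv.Term (Empty ⊕ Fin (k + 3)))) t) s : Fin (k + 2) → _) i)) =
      Fin.snoc (Fin.snoc p (t.realize (Sum.elim default (Fin.snoc (Fin.snoc (Fin.snoc p x) w) w'))))
        (s.realize (Sum.elim default (Fin.snoc (Fin.snoc (Fin.snoc p x) w) w'))) := by
    intro t s; funext i
    cases i using Fin.lastCases with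
    | last => simp
    | cast i =>
      cases i using Fin.lastCases with
      | last => simp
      | cast i => simp
  have ev1 : ∀ (t : Language.pv.Term (Empty ⊕ Fin (k + 3))),
      (fun i => Term.realize (Sum.elim (default : Empty → K) (Fin.snoc (Fin.snoc (Fin.snoc p x) w) w'))
        ((Fin.snoc (fun i : Fin k => (cv (Fin.castSucc (Fin.castSucc (Fin.castSucc i))) :
          Language.pv.Term (Empty ⊕ Fin (k + 3)))) t : Fin (k + 1) → _) i)) =
      Fin.snoc p (t.realize (Sum.elim default (Fin.snoc (Fin.snoc (Fin.snoc p x) w) w'))) := by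
    intro t; funext i
    cases i using Fin.lastCases with
    | last => simp
    | cast i => simp
  simp only [stepTheta, realize_imp, realize_inf, realize_pvle, realize_substCtx, ev, Term.realize,
    ev1, realize_pvHalf']
  simp

/-- **`Σᵇ₁(PV)`-polynomial induction holds in every Herbrand-saturated model of `PV₁`**, for a
`Σᵇ₁(PV)` formula in context variables `(p̄, x)` (Krajíček 1995, Thm. 7.6.3 (1), for `PV₁`;
Avigad 2002, §4). [cite: Krajicek1995, Thm. 7.6.3] -/
theorem pind_of_isSigmabPV_one (hK : K ⊨ PV1) (hsat : IsHerbrandSaturated Language.pv K)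
    {φ : Language.pv.BoundedFormula Empty (k + 1)} (hφ : IsSigmabPV 1 φ) (p : Fin k → K)
    (h0 : φ.Realize default (Fin.snoc p 0))
    (hs : ∀ x : K, φ.Realize default (Fin.snoc p (mHalf x)) → φ.Realize default (Fin.snoc p x))
    (a : K) : φ.Realize default (Fin.snoc p a) := by
  have hD := model_PVdef_of_model_PV1 hK
  obtain ⟨E, T, hE, hT, snd, cpl⟩ := hasSigmaFormPV_of_isSigmabPV_one hφ
  -- 1. the witness at `0`
  obtain ⟨w₀, hw₀, hE₀⟩ := cpl K hK hsat (Fin.snoc p 0) h0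
  rw [mLe_iff] at hw₀
  -- 2. a Skolem symbol for the step
  have hstep : ∀ x w : K, ∃ w' : K,
      (stepTheta E T).Realize default (Fin.snoc (Fin.snoc (Fin.snoc p x) w) w') := by
    intro x w
    by_cases hxw : w ≤ papp T (Fin.snoc p (mHalf x)) ∧ E.Realize default (Fin.snoc (Fin.snoc p (mHalf x)) w)
    · have hA : φ.Realize default (Fin.snoc p x) :=
        hs x (snd K hK (Fin.snoc p (mHalf x)) w ((mLe_iff _ _).2 hxw.1) hxw.2)
      obtain ⟨w', hw', hE'⟩ := cpl K hK hsat (Fin.snoc p x) hA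
      exact ⟨w', (realize_stepTheta E T p x w w').2 fun _ => ⟨(mLe_iff _ _).1 hw', hE'⟩⟩
    · exact ⟨0, (realize_stepTheta E T p x w 0).2 fun h => absurd h hxw⟩
  obtain ⟨q, c, G, hG⟩ := exists_skolem_sym_ctx₂ hK hsat (isQF_stepTheta hE T) p hstep
  have hG' : ∀ x w : K, w ≤ papp T (Fin.snoc p (mHalf x)) →
      E.Realize default (Fin.snoc (Fin.snoc p (mHalf x)) w) →
      papp G (Fin.snoc (Fin.snoc c x) w) ≤ papp T (Fin.snoc p x) ∧
        E.Realize default (Fin.snoc (Fin.snoc p x) (papp G (Fin.snoc (Fin.snoc c x) w))) :=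
    fun x w h1 h2 => (realize_stepTheta E T p x w _).1 (hG x w) ⟨h1, h2⟩
  -- 3. iterate along the notation, below the constant bound `K₀ = T(p̄, a)`
  set K₀ : K := papp T (Fin.snoc p a) with hK₀
  have hTmono : ∀ {x : K}, x ≤ a → papp T (Fin.snoc p x) ≤ K₀ := by
    intro x hx
    refine papp_mono hK hT fun i => ?_
    cases i using Fin.lastCases with
    | last => simpa using hx
    | cast i => simp
  let H : K → K := fun x => papp (PVFun.iterSym G) (Fin.snoc (Fin.snoc (Fin.snoc c w₀) K₀) x)
  have hH0 : H 0 = w₀ := by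
    show papp (PVFun.iterSym G) _ = w₀
    rw [iterSym_zero hD, min_eq_left (hw₀.trans (hTmono bot_le))]
  -- 4. open `PIND` in `K` on the invariant
  have key : ∀ x : K, x ≤ a → H x ≤ papp T (Fin.snoc p x) ∧
      E.Realize default (Fin.snoc (Fin.snoc p x) (H x)) := by
    intro x
    refine IsQFPVDef.pind hK (P := fun x => x ≤ a → H x ≤ papp T (Fin.snoc p x) ∧
      E.Realize default (Fin.snoc (Fin.snoc p x) (H x))) ?_ ?_ ?_ x
    · have hHdef : IsPVTermFn fun v : Fin 1 → K => H (v 0) :=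
        isPVTermFn_app_snoc1 _ _ isPVTermFn_v0
      refine IsQFPVDef.imp (IsQFPVDef.le' isPVTermFn_v0 (IsPVTermFn.const a))
        (IsQFPVDef.and (IsQFPVDef.le' hHdef (isPVTermFn_app_snoc1 _ p isPVTermFn_v0)) ?_)
      refine isQFPVDef_realize_of_isQF hE (F := fun i v => (Fin.snoc (Fin.snoc p (v 0)) (H (v 0)) :
        Fin (k + 2) → K) i) fun i => ?_
      cases i using Fin.lastCases with
      | last => simpa using hHdef
      | cast i =>
        cases i using Fin.lastCases with
        | last => simpa using isPVTermFn_v0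
        | cast i => simpa using IsPVTermFn.const (p i)
    · intro _
      rw [hH0]; exact ⟨hw₀, hE₀⟩
    · intro x ih hxa
      rcases eq_zero_or_eq_pbit hD x with hx0 | ⟨b, hxb, hne⟩
      · rw [hx0, hH0]; exact ⟨hw₀, hE₀⟩
      · obtain ⟨ih1, ih2⟩ := ih ((mHalf_le x).trans hxa)
        obtain ⟨hG1, hG2⟩ := hG' x (H (mHalf x)) ih1 ih2
        have hHx : H x = papp G (Fin.snoc (Fin.snoc c x) (H (mHalf x))) := by
          show papp (PVFun.iterSym G) (Fin.snoc (Fin.snoc (Fin.snoc c w₀) K₀) x) = _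
          conv_lhs => rw [hxb]
          rw [iterSym_pbit hD G c w₀ K₀ hne, ← hxb]
          exact min_eq_left (hG1.trans (hTmono hxa))
        rw [hHx]
        exact ⟨hG1, hG2⟩
  obtain ⟨h1, h2⟩ := key a le_rfl
  exact snd K hK (Fin.snoc p a) (H a) ((mLe_iff _ _).2 h1) h2

omit hKB in
/-- **`Σᵇ₁(PV)-PIND` axioms hold in Herbrand-saturated models of `PV₁`.** [cite: Krajicek1995, Thm. 7.6.3] -/
theorem realize_pvPindAxiom_of_isSigmabPV_one (hK : K ⊨ PV1)
    (hsat : IsHerbrandSaturated Language.pv K) {ψ : Language.pv.Formula (Fin (k + 1))}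
    (hψ : IsSigmabPV 1 ψ) : K ⊨ pvPindAxiom ψ := by
  haveI : K ⊨ BASIC := model_BASIC_of_model_PV1 hK
  rw [realize_pvPindAxiom_iff]
  intro p h0 hs a
  let φ : Language.pv.BoundedFormula Empty (k + 1) :=
    BoundedFormula.relabel (Sum.inr : Fin (k + 1) → Empty ⊕ Fin (k + 1)) ψ
  have hφ : IsSigmabPV 1 φ := hψ.relabel (Sum.inr : Fin (k + 1) → Empty ⊕ Fin (k + 1))
  have e : ∀ xs : Fin (k + 1) → K, φ.Realize default xs ↔ ψ.Realize xs :=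
    fun xs => Formula.realize_relabel_sumInr ψ
  rw [← e]
  refine pind_of_isSigmabPV_one hK hsat hφ p ((e _).2 h0) (fun x hx => ?_) a
  exact (e _).2 (hs x ((e _).1 hx))

end PIND

end PV1

/-- **Herbrand-saturated models of `PV₁` are models of `S₂¹(PV)`** (Krajíček 1995, Thm. 7.6.3 (1)
for `PV₁`; Avigad 2002, §4): `BASIC` and `PVdef` are axioms of `PV₁`, and every
`Σᵇ₁(PV)-PIND` axiom holds by `PV1.realize_pvPindAxiom_of_isSigmabPV_one`.
[cite: Krajicek1995, Thm. 7.6.3] -/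
theorem model_S2PV_one_of_isHerbrandSaturated {K : Type} [Language.pv.Structure K]
    (hK : K ⊨ PV1) (hsat : Literature.ModelTheory.UniversalTheories.IsHerbrandSaturated
      Language.pv K) : K ⊨ S2PV 1 := by
  have hB : K ⊨ boundedArithToPV.onTheory BASIC :=
    hK.mono (Set.subset_union_right.trans Set.subset_union_left)
  have hD : K ⊨ PVdef := model_PVdef_of_model_PV1 hK
  refine (hB.union hD).union ⟨fun σ hσ => ?_⟩
  simp only [Set.mem_iUnion, Set.mem_image] at hσ
  obtain ⟨k, ψ, hψ, rfl⟩ := hσ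
  exact PV1.realize_pvPindAxiom_of_isSigmabPV_one hK hsat hψ


/-! ## The conservation theorem -/

/-- **`Σᵇ₁(PV)` formulas are reflected by universal-preserving maps into Herbrand-saturated models
of `PV₁`**: if `f : M → K` preserves universal formulas with parameters, `M, K ⊨ PV₁`, `K` is
Herbrand saturated and `ψ ∈ Σᵇ₁(PV)`, then `K ⊨ ψ(f x̄)` implies `M ⊨ ψ(x̄)` (through the witness
form of `ψ`). [cite: Krajicek1995, Thm. 7.6.3] -/
theorem realize_of_realize_comp_of_isSigmabPV_one {M K : Type} [Language.pv.Structure M]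
    [Language.pv.Structure K] (hM : M ⊨ PV1) (hK : K ⊨ PV1)
    (hsat : IsHerbrandSaturated Language.pv K) {f : M → K} (hf : PreservesUniversal Language.pv f)
    {n : ℕ} {ψ : Language.pv.BoundedFormula Empty n} (hψ : IsSigmabPV 1 ψ) (xs : Fin n → M)
    (h : ψ.Realize default (f ∘ xs)) : ψ.Realize default xs := by
  haveI : M ⊨ BASIC := model_BASIC_of_model_PV1 hM
  haveI : K ⊨ BASIC := model_BASIC_of_model_PV1 hK
  obtain ⟨E, T, hE, _, snd, cpl⟩ := hasSigmaFormPV_of_isSigmabPV_one hψ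
  obtain ⟨w, hw, hEw⟩ := cpl K hK hsat (f ∘ xs) h
  by_contra hno
  -- the universal statement `∀ w ¬ (w ≤ T(x̄) ∧ E(x̄, w))` holds in `M` …
  let χ : Language.pv.BoundedFormula Empty n := (∼(Term.le (cv (Fin.last n)) (upSym T) ⊓ E)).all
  have hχ : χ.IsUniversal := (((IsAtomic.rel _ _).isQF.inf hE).not.isUniversal).all
  have hMχ : χ.Realize default xs := by
    simp only [χ, realize_all, realize_not, realize_inf, realize_pvle, Term.realize_var,
      Sum.elim_inr, Fin.snoc_last, realize_upSym]
    intro v hv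
    exact hno (snd M hM xs v ((mLe_iff _ _).2 hv.1) hv.2)
  -- … hence in `K` at `f x̄`, contradicting the witness
  have hKχ : χ.Realize default (f ∘ xs) := hf.realize_boundedFormula hχ xs hMχ
  simp only [χ, realize_all, realize_not, realize_inf, realize_pvle, Term.realize_var,
    Sum.elim_inr, Fin.snoc_last, realize_upSym] at hKχ
  exact hKχ w ⟨(mLe_iff _ _).1 hw, hEw⟩

/-- **`S₂¹(PV)` is `∀Σᵇ₁(PV)`-conservative over `PV₁`** (Buss 1986, Ch. 6, Thm. 6.4 and Cor. 6.8;
Krajíček 1995, Cor. 7.2.4, by the model-theoretic proof of Thm. 7.6.3; Avigad 2002, §4):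
discharge of the named fact `S2PV_one_isConservativeOver_PV1` of `PVTheory.lean`.
[cite: Krajicek1995, Cor. 7.2.4] -/
theorem S2PV_one_isConservativeOver_PV1_holds : S2PV_one_isConservativeOver_PV1 := by
  intro φ hφ hS
  obtain ⟨n, ψ, hψ, rfl⟩ := hφ
  rw [Theory.models_sentence_iff]
  intro M
  obtain ⟨K, _, f, hK, hsat, hf⟩ := exists_herbrandSaturated_model_PV1 M M.is_model
  haveI : K ⊨ S2PV 1 := model_S2PV_one_of_isHerbrandSaturated hK hsat
  haveI : Nonempty K := nonempty_of_pvStructure K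
  have hKψ : K ⊨ ψ.alls := hS.realize_sentence K
  simp only [Sentence.Realize, realize_alls] at hKψ ⊢
  intro xs
  exact realize_of_realize_comp_of_isSigmabPV_one M.is_model hK hsat hf hψ xs (hKψ (f ∘ xs))

end Literature.Analysis.FunctionSpaces
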